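import Summits.Ventures.Crystal3D.Theorems.StickyWulffConstantPolycrystalWulffBoundSortedTreeChimera
import Summits.Ventures.Crystal3D.Theorems.StickyWulffConstantPolycrystalWulffBoundPiecewiseChimera

/-!
# `PolycrystalWulffBound`, line `PolyDensity`: the chimera lower bound for a sorted TREE OF SUPER-GRAINS
# (crux `stmt-Ventures-19482`; engine-agnostic docking form)

Route `StickyWulffConstant` of the venture `Summits/Ventures/Crystal3D`, second prover lane (poly-p2,
gen 13).  `sortedTree_chimera_lower` (gen 12) treats a tree whose NODES are single grains: node `f` gets
the constant target `W(A_f) ∩ H_f`, `H_f` = «above the own edge's quantile, below every child's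
quantile», and plain Brunn–Minkowski per node sums to the exact chimera bound.  Here a node is a
SUPER-GRAIN — a finite union of cells `G_j` (`nd j = f`) with their own frames `A_j` — and the per-node
lower bound is a HYPOTHESIS in docking form (`hnode`): for every choice of levels `c` and every
measurable `C ⊇ ⋃_{nd j = f} (G_j + r·(W(A_j) ∩ H_f(c)))`,
`|⋃_{nd j = f} G_j|^{1/3} + r·|W(Aref_f) ∩ H_f(c)|^{1/3} ≤ |C|^{1/3}` (reference frame `Aref_f`).  It is
discharged by plain Brunn–Minkowski for a single-body node and by the truncated SLIDE chimera
(`slide_chimera_lower_trunc`, `…SlideChimeraTrunc`) for a single-axis twin network whose slide direction is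
`⊥` every incident edge normal — so inclined twin walls INSIDE a node are paid by that node's slide budget
while the tree edges (profile-matching walls: `hprof`) stay free.  Conclusion
(`superTree_chimera_lower`): `|⋃ G_j|^{1/3} + r·32^{1/3} ≤ |U|^{1/3}` for measurable
`U ⊇ ⋃_j (G_j + r·W(A_j))`, under the localized tree geometry of gen 12 (child node above its edge plane,
parent node below it wherever `δ`-close, non-adjacent nodes `δ`-separated, `r·2(√5+1) ≤ δ`).
* `chimera_lower_of_piece_root_bounds` — the exact summation of `…PiecewiseChimera` with per-piece
  bounds in ROOT form (what the node engines deliver).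
WHAT THIS IS NOT: the node engines or the rung; cycles in the adjacency graph; the crux is not claimed.
-/

noncomputable section

open scoped BigOperators InnerProductSpace ENNReal Pointwise
open MeasureTheory Set

namespace Summit.Ventures.Crystal3D.Theorems

open Summit.Ventures.Crystal3D.Cruxes.TextureLiminf.TexShadow (E3)
open Literature.MathematicalPhysics.StatisticalMechanics (fccStacking barlowStacking IsHaggSeq)

/-- **Chimera lower bound from per-piece bounds in ROOT form.**  Pieces `P f` (measurable, pairwise
disjoint, `0 < |⋃ P f| < ∞`), pairwise disjoint measurable `S f ⊆ U` with
`|P f|^{1/3} + r·(κ|P f|/|⋃ P|)^{1/3} ≤ |S f|^{1/3}` whenever `|P f| ≠ 0`: then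
`|⋃ P f|^{1/3} + r·κ^{1/3} ≤ |U|^{1/3}`. -/
theorem chimera_lower_of_piece_root_bounds {ι : Type*} [Fintype ι] (P : ι → Set E3)
    (hPm : ∀ f, MeasurableSet (P f)) (hdisjP : Pairwise fun f g => Disjoint (P f) (P g))
    (h0 : volume (⋃ f, P f) ≠ 0) (htop : volume (⋃ f, P f) ≠ ⊤) {κ r : ℝ} (hκ : 0 < κ) (hr : 0 < r)
    (S : ι → Set E3) (hSm : ∀ f, MeasurableSet (S f))
    (hdisj : Pairwise fun f g => Disjoint (S f) (S g)) {U : Set E3} (hsub : ∀ f, S f ⊆ U)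
    (hbound : ∀ f, volume (P f) ≠ 0 → volume (P f) ^ ((3 : ℕ)⁻¹ : ℝ) + ENNReal.ofReal r *
        (ENNReal.ofReal (κ * ((volume (P f)).toReal / (volume (⋃ f, P f)).toReal))) ^ ((3 : ℕ)⁻¹ : ℝ) ≤
      volume (S f) ^ ((3 : ℕ)⁻¹ : ℝ)) :
    volume (⋃ f, P f) ^ ((3 : ℕ)⁻¹ : ℝ) + ENNReal.ofReal r * (ENNReal.ofReal κ) ^ ((3 : ℕ)⁻¹ : ℝ) ≤
      volume U ^ ((3 : ℕ)⁻¹ : ℝ) := by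
  classical
  set V : ℝ≥0∞ := volume (⋃ f, P f) with hV
  have hVsum : V = ∑ f, volume (P f) := by
    rw [hV, measure_iUnion (fun f g h => hdisjP h) hPm, tsum_fintype]
  have hPfin : ∀ f, volume (P f) ≠ ⊤ := fun f =>
    (lt_of_le_of_lt (measure_mono (subset_iUnion P f)) htop.lt_top).ne
  set v : ι → ℝ := fun f => (volume (P f)).toReal with hv
  have hv0 : ∀ f, 0 ≤ v f := fun f => ENNReal.toReal_nonneg
  have hVr : V.toReal = ∑ f, v f := by rw [hVsum, ENNReal.toReal_sum fun f _ => hPfin f]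
  have hn3 : (3 : ℕ) ≠ 0 := by norm_num
  set θ : ℝ := ((3 : ℕ) : ℝ)⁻¹ with hθ
  have hθ0 : 0 < θ := by rw [hθ]; positivity
  refine chimera_lower_of_piece_bounds v hv0 h0 htop hVr hκ hr S hSm hdisj hsub fun f => ?_
  have hKV : 0 ≤ κ * (v f / V.toReal) := mul_nonneg hκ.le (div_nonneg (hv0 f) ENNReal.toReal_nonneg)
  by_cases hf : volume (P f) = 0
  · have hvf : v f = 0 := by simp only [hv, hf, ENNReal.toReal_zero]
    have hθne : ((3 : ℕ) : ℝ)⁻¹ ≠ 0 := by positivity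
    rw [hvf, zero_div, mul_zero, Real.zero_rpow hθne, mul_zero, add_zero, zero_pow hn3,
      ENNReal.ofReal_zero]
    exact bot_le
  · have h := hbound f hf
    set a : ℝ := v f ^ θ with ha
    set b : ℝ := r * (κ * (v f / V.toReal)) ^ θ with hb
    have ha0 : 0 ≤ a := Real.rpow_nonneg (hv0 f) _
    have hb0 : 0 ≤ b := mul_nonneg hr.le (Real.rpow_nonneg hKV _)
    have hA : volume (P f) ^ θ = ENNReal.ofReal a := by
      rw [ha, hv, ← ENNReal.ofReal_rpow_of_nonneg ENNReal.toReal_nonneg hθ0.le,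
        ENNReal.ofReal_toReal (hPfin f)]
    have hB : ENNReal.ofReal r * (ENNReal.ofReal (κ * (v f / V.toReal))) ^ θ = ENNReal.ofReal b := by
      rw [hb, ENNReal.ofReal_mul hr.le, ENNReal.ofReal_rpow_of_nonneg hKV hθ0.le]
    have hab : ENNReal.ofReal (a + b) ≤ volume (S f) ^ θ := by
      rw [ENNReal.ofReal_add ha0 hb0, ← hA, ← hB]; exact h
    have h3 : (ENNReal.ofReal (a + b)) ^ 3 ≤ (volume (S f) ^ θ) ^ 3 := by gcongr
    rw [← ENNReal.ofReal_pow (add_nonneg ha0 hb0), hθ, ENNReal.rpow_inv_natCast_pow hn3] at h3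
    exact h3

/-- **Chimera lower bound for a sorted tree of SUPER-GRAINS** (docking form).  Tree `Fin (N+1)` (root
`0`, parent of `i.succ` is `par i ≤ i`), edge `i` with unit wall normal `n i` and threshold `t i`;
node reference frames `Aref` with matching cap-volume profiles across every edge (`hprof`); cells `G j`
(open, pairwise disjoint, `0 < |⋃ G j| < ∞`) with frames `A j`, assigned to nodes by `nd`; the cells of
node `i.succ` lie in `{t i < ⟪x, n i⟫}`, the cells of node `par i` lie in `{⟪x, n i⟫ < t i}` wherever
`δ`-close to node `i.succ`, cells of non-adjacent distinct nodes are `δ`-separated, `r·2(√5+1) ≤ δ`;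
`U ⊇ ⋃_j (G j + r·W(A j))` measurable; and the PER-NODE chimera bound `hnode` (see the file header).
Then `|⋃ G j|^{1/3} + r·32^{1/3} ≤ |U|^{1/3}`. -/
theorem superTree_chimera_lower {N M : ℕ} (par : Fin N → Fin (N + 1)) (hpar : ∀ i, (par i : ℕ) ≤ i)
    (n : Fin N → E3) (t : Fin N → ℝ) (hn1 : ∀ i, ‖n i‖ = 1) (Aref : Fin (N + 1) → (E3 ≃ₗᵢ[ℝ] E3))
    (hprof : ∀ i (s : ℝ), volume ({y : E3 | ∀ ν : E3, ⟪y, ν⟫_ℝ ≤ Real.sqrt 2 / 4 *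
        ∑ᶠ w ∈ {w | w ∈ fccStacking 1 (Real.sqrt (2 / 3)) ∧ ‖w‖ = 1}, |⟪w, (Aref i.succ).symm ν⟫_ℝ|} ∩
        {y : E3 | s < ⟪y, n i⟫_ℝ}) =
      volume ({y : E3 | ∀ ν : E3, ⟪y, ν⟫_ℝ ≤ Real.sqrt 2 / 4 *
        ∑ᶠ w ∈ {w | w ∈ fccStacking 1 (Real.sqrt (2 / 3)) ∧ ‖w‖ = 1}, |⟪w, (Aref (par i)).symm ν⟫_ℝ|} ∩
        {y : E3 | s < ⟪y, n i⟫_ℝ}))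
    (nd : Fin M → Fin (N + 1)) (G : Fin M → Set E3) (A : Fin M → (E3 ≃ₗᵢ[ℝ] E3))
    (hGo : ∀ j, IsOpen (G j)) (hdisjG : ∀ j j', j ≠ j' → Disjoint (G j) (G j'))
    (hGt : ∀ i j, nd j = i.succ → ∀ x ∈ G j, t i < ⟪x, n i⟫_ℝ) {δ : ℝ}
    (hPt : ∀ i j, nd j = par i → ∀ x ∈ G j,
      ⟪x, n i⟫_ℝ < t i ∨ ∀ j', nd j' = i.succ → ∀ y ∈ G j', δ ≤ dist x y)
    (hsep : ∀ j j', nd j ≠ nd j' → (∀ i, ¬ (nd j = par i ∧ nd j' = i.succ)) →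
      (∀ i, ¬ (nd j' = par i ∧ nd j = i.succ)) → ∀ x ∈ G j, ∀ y ∈ G j', δ ≤ dist x y)
    (h0 : volume (⋃ j, G j) ≠ 0) (htop : volume (⋃ j, G j) ≠ ⊤)
    {r : ℝ} (hr : 0 < r) (hrδ : r * (2 * (Real.sqrt 5 + 1)) ≤ δ) {U : Set E3} (hU : MeasurableSet U)
    (hsub : ∀ j, ∀ x ∈ G j, ∀ w ∈ {y : E3 | ∀ ν : E3, ⟪y, ν⟫_ℝ ≤ Real.sqrt 2 / 4 *
        ∑ᶠ w ∈ {w | w ∈ fccStacking 1 (Real.sqrt (2 / 3)) ∧ ‖w‖ = 1}, |⟪w, (A j).symm ν⟫_ℝ|},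
      x + r • w ∈ U)
    (hnode : ∀ (f : Fin (N + 1)) (c : Fin N → ℝ) (C : Set E3), MeasurableSet C →
      volume (⋃ j, ⋃ (_ : nd j = f), G j) ≠ 0 →
      volume ({y : E3 | ∀ ν : E3, ⟪y, ν⟫_ℝ ≤ Real.sqrt 2 / 4 *
          ∑ᶠ w ∈ {w | w ∈ fccStacking 1 (Real.sqrt (2 / 3)) ∧ ‖w‖ = 1}, |⟪w, (Aref f).symm ν⟫_ℝ|} ∩
        ((⋂ i ∈ Finset.univ.filter (fun i => par i = f), {y : E3 | ⟪y, n i⟫_ℝ ≤ c i}) ∩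
          ⋂ i ∈ Finset.univ.filter (fun i : Fin N => f = i.succ), {y : E3 | c i < ⟪y, n i⟫_ℝ})) ≠ 0 →
      (∀ j, nd j = f → ∀ x ∈ G j, ∀ y ∈ {y : E3 | ∀ ν : E3, ⟪y, ν⟫_ℝ ≤ Real.sqrt 2 / 4 *
          ∑ᶠ w ∈ {w | w ∈ fccStacking 1 (Real.sqrt (2 / 3)) ∧ ‖w‖ = 1}, |⟪w, (A j).symm ν⟫_ℝ|} ∩
        ((⋂ i ∈ Finset.univ.filter (fun i => par i = f), {y : E3 | ⟪y, n i⟫_ℝ ≤ c i}) ∩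
          ⋂ i ∈ Finset.univ.filter (fun i : Fin N => f = i.succ), {y : E3 | c i < ⟪y, n i⟫_ℝ}),
        x + r • y ∈ C) →
      volume (⋃ j, ⋃ (_ : nd j = f), G j) ^ ((3 : ℕ)⁻¹ : ℝ) + ENNReal.ofReal r *
        (volume ({y : E3 | ∀ ν : E3, ⟪y, ν⟫_ℝ ≤ Real.sqrt 2 / 4 *
          ∑ᶠ w ∈ {w | w ∈ fccStacking 1 (Real.sqrt (2 / 3)) ∧ ‖w‖ = 1}, |⟪w, (Aref f).symm ν⟫_ℝ|} ∩
        ((⋂ i ∈ Finset.univ.filter (fun i => par i = f), {y : E3 | ⟪y, n i⟫_ℝ ≤ c i}) ∩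
          ⋂ i ∈ Finset.univ.filter (fun i : Fin N => f = i.succ), {y : E3 | c i < ⟪y, n i⟫_ℝ}))) ^
          ((3 : ℕ)⁻¹ : ℝ) ≤
      volume C ^ ((3 : ℕ)⁻¹ : ℝ)) :
    volume (⋃ j, G j) ^ ((3 : ℕ)⁻¹ : ℝ) +
        ENNReal.ofReal r * (ENNReal.ofReal 32) ^ ((3 : ℕ)⁻¹ : ℝ) ≤ volume U ^ ((3 : ℕ)⁻¹ : ℝ) := by
  classical
  -- the bodies
  set body : (E3 ≃ₗᵢ[ℝ] E3) → Set E3 := fun X => {y : E3 | ∀ ν : E3, ⟪y, ν⟫_ℝ ≤ Real.sqrt 2 / 4 *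
    ∑ᶠ w ∈ {w | w ∈ fccStacking 1 (Real.sqrt (2 / 3)) ∧ ‖w‖ = 1}, |⟪w, X.symm ν⟫_ℝ|} with hbody
  have hWball : ∀ X, body X ⊆ Metric.closedBall (0 : E3) (Real.sqrt 5) :=
    fun X => cruxWulffBody_subset_closedBall X
  have hWvol : ∀ X, volume (body X) = ENNReal.ofReal 32 := fun X => volume_cruxWulffBody X
  have h51 : 0 < 2 * (Real.sqrt 5 + 1) := by positivity
  -- the nodes (super-grains)
  set Nd : Fin (N + 1) → Set E3 := fun f => ⋃ j, ⋃ (_ : nd j = f), G j with hNd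
  have hmemNd : ∀ f x, x ∈ Nd f ↔ ∃ j, nd j = f ∧ x ∈ G j := by
    intro f x; simp only [hNd, mem_iUnion, exists_prop]
  have hNdo : ∀ f, IsOpen (Nd f) := fun f => isOpen_iUnion fun j => isOpen_iUnion fun _ => hGo j
  have hNdm : ∀ f, MeasurableSet (Nd f) := fun f => (hNdo f).measurableSet
  have hdisjNd : Pairwise fun f g => Disjoint (Nd f) (Nd g) := by
    intro f g hfg
    rw [Set.disjoint_left]
    intro x hx hx'
    obtain ⟨j, hj, hxj⟩ := (hmemNd f x).1 hx
    obtain ⟨j', hj', hxj'⟩ := (hmemNd g x).1 hx'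
    have hjj : j ≠ j' := fun e => hfg (hj.symm.trans (e ▸ hj'))
    exact Set.disjoint_left.1 (hdisjG j j' hjj) hxj hxj'
  have hUnion : (⋃ j, G j) = ⋃ f, Nd f := by
    ext x
    simp only [mem_iUnion, hmemNd]
    exact ⟨fun ⟨j, hx⟩ => ⟨nd j, j, rfl, hx⟩, fun ⟨_, j, _, hx⟩ => ⟨j, hx⟩⟩
  -- volumes, fractions, subtree weights
  set V : ℝ≥0∞ := volume (⋃ j, G j) with hV
  have hVsum : V = ∑ f, volume (Nd f) := by
    rw [hV, hUnion, measure_iUnion (fun f g h => hdisjNd h) hNdm, tsum_fintype]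
  have hNdfin : ∀ f, volume (Nd f) ≠ ⊤ := fun f =>
    (lt_of_le_of_lt (measure_mono (hUnion ▸ subset_iUnion Nd f)) htop.lt_top).ne
  set Vr : ℝ := V.toReal with hVr
  set σ : Fin (N + 1) → ℝ := fun f => (volume (Nd f)).toReal / Vr with hσ
  have hVr0 : 0 < Vr := ENNReal.toReal_pos h0 htop
  have hσ0 : ∀ f, 0 ≤ σ f := fun f => div_nonneg ENNReal.toReal_nonneg hVr0.le
  have hσ1 : ∑ f, σ f = 1 := by
    simp only [hσ]
    rw [← Finset.sum_div, ← ENNReal.toReal_sum (fun f _ => hNdfin f), ← hVsum, div_self hVr0.ne']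
  obtain ⟨u, hrec, hu0, hu1, hroot⟩ := exists_subtreeWeights par hpar σ hσ0 hσ1
  -- exact cap heights of the children, in the parent's reference body and in the child's
  have hs : ∀ i, ∃ s : ℝ, |s| ≤ Real.sqrt 5 + 1 ∧
      volume (body (Aref (par i)) ∩ {y : E3 | s < ⟪y, n i⟫_ℝ}) = ENNReal.ofReal (32 * u i.succ) :=
    fun i => exists_capHeight_eq (Aref (par i)) (n i) (hn1 i) (hu0 _) (hu1 _)
  choose s hsR hsP using hs
  have hsC : ∀ i, volume (body (Aref i.succ) ∩ {y : E3 | s i < ⟪y, n i⟫_ℝ}) =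
      ENNReal.ofReal (32 * u i.succ) := by
    intro i
    have h := hprof i (s i)
    show volume (body (Aref i.succ) ∩ {y : E3 | s i < ⟪y, n i⟫_ℝ}) = ENNReal.ofReal (32 * u i.succ)
    simp only [hbody]
    rw [h]
    exact hsP i
  -- the truncations `H f` and the reference targets `T f = body (Aref f) ∩ H f`
  set H : Fin (N + 1) → Set E3 := fun f =>
    (⋂ i ∈ Finset.univ.filter (fun i => par i = f), {y : E3 | ⟪y, n i⟫_ℝ ≤ s i}) ∩
      ⋂ i ∈ Finset.univ.filter (fun i : Fin N => f = i.succ), {y : E3 | s i < ⟪y, n i⟫_ℝ} with hH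
  set T : Fin (N + 1) → Set E3 := fun f => body (Aref f) ∩ H f with hT
  have hmemC : ∀ f (y : E3), y ∈ (⋂ i ∈ Finset.univ.filter (fun i => par i = f),
      {y : E3 | ⟪y, n i⟫_ℝ ≤ s i}) ↔ ∀ i, par i = f → ⟪y, n i⟫_ℝ ≤ s i := by
    intro f y
    simp only [mem_iInter, Finset.mem_filter, Finset.mem_univ, true_and, mem_setOf_eq]
  have hmemO : ∀ f (y : E3), y ∈ (⋂ i ∈ Finset.univ.filter (fun i : Fin N => f = i.succ),
      {y : E3 | s i < ⟪y, n i⟫_ℝ}) ↔ ∀ i : Fin N, f = i.succ → s i < ⟪y, n i⟫_ℝ := by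
    intro f y
    simp only [mem_iInter, Finset.mem_filter, Finset.mem_univ, true_and, mem_setOf_eq]
  -- target volumes: own cap (volume `32·u f`) minus the children's caps
  have hTvol : ∀ f, ENNReal.ofReal (32 * σ f) ≤ volume (T f) := by
    intro f
    set Own : Set E3 := body (Aref f) ∩ ⋂ i ∈ Finset.univ.filter (fun i : Fin N => f = i.succ),
      {y : E3 | s i < ⟪y, n i⟫_ℝ} with hOwn
    have hOwnvol : volume Own = ENNReal.ofReal (32 * u f) := by
      induction f using Fin.cases with
      | zero =>
        have : Own = body (Aref 0) := by
          rw [hOwn]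
          refine inter_eq_left.2 fun y _ => (hmemO 0 y).2 fun i hi => absurd hi (Fin.succ_ne_zero i).symm
        rw [this, hWvol, hroot, mul_one]
      | succ j₀ =>
        have : Own = body (Aref j₀.succ) ∩ {y : E3 | s j₀ < ⟪y, n j₀⟫_ℝ} := by
          rw [hOwn]
          ext y
          simp only [mem_inter_iff, hmemO]
          constructor
          · rintro ⟨hy, h⟩; exact ⟨hy, h j₀ rfl⟩
          · rintro ⟨hy, h⟩
            refine ⟨hy, fun i hi => ?_⟩
            have hii : j₀ = i := Fin.succ_inj.1 hi
            subst hii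
            exact h
        rw [this, hsC j₀]
    have hcov : Own ⊆ T f ∪ ⋃ i ∈ Finset.univ.filter (fun i => par i = f),
        (body (Aref f) ∩ {y : E3 | s i < ⟪y, n i⟫_ℝ}) := by
      rintro y ⟨hy, hyo⟩
      by_cases h : ∀ i, par i = f → ⟪y, n i⟫_ℝ ≤ s i
      · exact Or.inl ⟨hy, (hmemC f y).2 h, hyo⟩
      · simp only [not_forall, not_le] at h
        obtain ⟨i, hi, hlt⟩ := h
        exact Or.inr (mem_iUnion₂.2 ⟨i, Finset.mem_filter.2 ⟨Finset.mem_univ _, hi⟩, hy, hlt⟩)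
    have hchildvol : ∀ i ∈ Finset.univ.filter (fun i => par i = f),
        volume (body (Aref f) ∩ {y : E3 | s i < ⟪y, n i⟫_ℝ}) = ENNReal.ofReal (32 * u i.succ) := by
      intro i hi
      rw [Finset.mem_filter] at hi
      rw [← hi.2]
      exact hsP i
    have h1 : ENNReal.ofReal (32 * u f) ≤ volume (T f) +
        ∑ i ∈ Finset.univ.filter (fun i => par i = f), ENNReal.ofReal (32 * u i.succ) := by
      rw [← hOwnvol, ← Finset.sum_congr rfl hchildvol]
      exact (measure_mono hcov).trans ((measure_union_le _ _).trans
        (add_le_add le_rfl (measure_biUnion_finset_le _ _)))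
    rw [hrec f, mul_add, Finset.mul_sum, ENNReal.ofReal_add (mul_nonneg (by norm_num) (hσ0 f))
      (Finset.sum_nonneg fun i _ => mul_nonneg (by norm_num) (hu0 _)),
      ENNReal.ofReal_sum_of_nonneg (fun i _ => mul_nonneg (by norm_num) (hu0 _))] at h1
    exact (ENNReal.add_le_add_iff_right (ENNReal.sum_ne_top.2 fun i _ => ENNReal.ofReal_ne_top)).1 h1
  -- the regions
  set ρ : ℝ := r * (Real.sqrt 5 + 1) with hρ
  have hρ0 : 0 < ρ := by positivity
  set a : Fin N → ℝ := fun i => t i + r * s i with ha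
  set R : Fin (N + 1) → Set E3 := fun f =>
    ((⋂ i ∈ Finset.univ.filter (fun i => par i = f),
        ((Metric.thickening ρ (Nd i.succ))ᶜ ∪ {y : E3 | ⟪y, n i⟫_ℝ < a i})) ∩
      ⋂ i ∈ Finset.univ.filter (fun i : Fin N => f = i.succ), {y : E3 | a i < ⟪y, n i⟫_ℝ}) ∩
    Metric.thickening ρ (Nd f) with hR
  have hmemRC : ∀ f (y : E3), y ∈ (⋂ i ∈ Finset.univ.filter (fun i => par i = f),
      ((Metric.thickening ρ (Nd i.succ))ᶜ ∪ {y : E3 | ⟪y, n i⟫_ℝ < a i})) ↔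
      ∀ i, par i = f → y ∈ Metric.thickening ρ (Nd i.succ) → ⟪y, n i⟫_ℝ < a i := by
    intro f y
    simp only [mem_iInter, Finset.mem_filter, Finset.mem_univ, true_and, mem_union, mem_compl_iff,
      mem_setOf_eq]
    exact forall_congr' fun i => forall_congr' fun _ => ⟨fun h hy => h.resolve_left (fun hn => hn hy),
      fun h => (em (y ∈ Metric.thickening ρ (Nd i.succ))).elim (fun hy => Or.inr (h hy)) Or.inl⟩
  have hmemRO : ∀ f (y : E3), y ∈ (⋂ i ∈ Finset.univ.filter (fun i : Fin N => f = i.succ),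
      {y : E3 | a i < ⟪y, n i⟫_ℝ}) ↔ ∀ i : Fin N, f = i.succ → a i < ⟪y, n i⟫_ℝ := by
    intro f y
    simp only [mem_iInter, Finset.mem_filter, Finset.mem_univ, true_and, mem_setOf_eq]
  have hlt_m : ∀ i (c : ℝ), MeasurableSet {y : E3 | c < ⟪y, n i⟫_ℝ} := fun i c =>
    measurableSet_lt measurable_const (measurable_id.inner measurable_const)
  have hgt_m : ∀ i (c : ℝ), MeasurableSet {y : E3 | ⟪y, n i⟫_ℝ < c} := fun i c =>
    measurableSet_lt (measurable_id.inner measurable_const) measurable_const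
  have hRm : ∀ f, MeasurableSet (R f) := fun f =>
    ((Finset.measurableSet_biInter _ fun i _ =>
        (Metric.isOpen_thickening.measurableSet.compl).union (hgt_m i _)).inter
      (Finset.measurableSet_biInter _ fun i _ => hlt_m i _)).inter
      Metric.isOpen_thickening.measurableSet
  -- disjointness of the regions
  have hthick : ∀ f g : Fin (N + 1), (∀ x ∈ Nd f, ∀ y ∈ Nd g, δ ≤ dist x y) →
      Disjoint (Metric.thickening ρ (Nd f)) (Metric.thickening ρ (Nd g)) := by
    intro f g hfg
    rw [Set.disjoint_left]
    intro y hyf hyg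
    obtain ⟨x, hx, hdx⟩ := Metric.mem_thickening_iff.1 hyf
    obtain ⟨x', hx', hdx'⟩ := Metric.mem_thickening_iff.1 hyg
    have h1 : δ ≤ dist x x' := hfg x hx x' hx'
    have h2 : dist x x' < ρ + ρ := (dist_triangle x y x').trans_lt (by
      rw [dist_comm x y]; exact add_lt_add hdx hdx')
    have h3 : 2 * ρ ≤ δ := by rw [hρ]; linarith
    linarith
  have hRadj : ∀ i, Disjoint (U ∩ R (par i)) (U ∩ R i.succ) := by
    intro i
    rw [Set.disjoint_left]
    rintro y ⟨-, ⟨hyc, -⟩, -⟩ ⟨-, ⟨-, hyo⟩, hyt⟩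
    have h1 : ⟪y, n i⟫_ℝ < a i := (hmemRC _ y).1 hyc i rfl hyt
    have h2 : a i < ⟪y, n i⟫_ℝ := (hmemRO _ y).1 hyo i rfl
    exact lt_irrefl _ (h1.trans h2)
  have hdisjR : Pairwise fun f g => Disjoint (U ∩ R f) (U ∩ R g) := by
    intro f g hfg
    by_cases h1 : ∃ i, f = par i ∧ g = i.succ
    · obtain ⟨i, rfl, rfl⟩ := h1
      exact hRadj i
    by_cases h2 : ∃ i, g = par i ∧ f = i.succ
    · obtain ⟨i, rfl, rfl⟩ := h2
      exact (hRadj i).symm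
    simp only [not_exists] at h1 h2
    refine (hthick f g fun x hx y hy => ?_).mono (fun y hy => hy.2.2) (fun y hy => hy.2.2)
    obtain ⟨j, hj, hxj⟩ := (hmemNd f x).1 hx
    obtain ⟨j', hj', hyj'⟩ := (hmemNd g y).1 hy
    subst hj; subst hj'
    exact hsep j j' hfg h1 h2 x hxj y hyj'
  -- the swollen pieces of the cells of node `f` lie in `U ∩ R f`
  have hinc : ∀ j, ∀ x ∈ G j, ∀ p ∈ body (A j) ∩ H (nd j), x + r • p ∈ U ∩ R (nd j) := by
    intro j x hx p hp
    have hp5 : ‖p‖ ≤ Real.sqrt 5 := mem_closedBall_zero_iff.1 (hWball (A j) hp.1)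
    have h1 : ∀ i, ⟪x + r • p, n i⟫_ℝ = ⟪x, n i⟫_ℝ + r * ⟪p, n i⟫_ℝ := fun i => by
      rw [inner_add_left, inner_smul_left]; simp
    have hxNd : x ∈ Nd (nd j) := (hmemNd _ x).2 ⟨j, rfl, hx⟩
    refine ⟨hsub j x hx p hp.1, ⟨(hmemRC _ _).2 fun i hi hz => ?_, (hmemRO _ _).2 fun i hi => ?_⟩, ?_⟩
    · -- near the child node `i.succ`: the point of the parent node lies below the edge plane
      obtain ⟨y, hyL, hdy⟩ := Metric.mem_thickening_iff.1 hz
      obtain ⟨j', hj', hyj'⟩ := (hmemNd _ y).1 hyL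
      have hdist : dist x y < δ :=
        calc dist x y ≤ dist x (x + r • p) + dist (x + r • p) y := dist_triangle _ _ _
          _ = r * ‖p‖ + dist (x + r • p) y := by
              rw [dist_eq_norm, sub_add_cancel_left, norm_neg, norm_smul, Real.norm_of_nonneg hr.le]
          _ < r * Real.sqrt 5 + ρ := add_lt_add_of_le_of_lt (by gcongr) hdy
          _ ≤ δ := by rw [hρ]; nlinarith
      have hxt : ⟪x, n i⟫_ℝ < t i := by
        rcases hPt i j hi.symm x hx with h | h
        · exact h
        · exact absurd (h j' hj' y hyj') (not_le.2 hdist)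
      have hpi : ⟪p, n i⟫_ℝ ≤ s i := (hmemC _ p).1 hp.2.1 i hi
      show ⟪x + r • p, n i⟫_ℝ < t i + r * s i
      rw [h1]
      have h2 : r * ⟪p, n i⟫_ℝ ≤ r * s i := mul_le_mul_of_nonneg_left hpi hr.le
      linarith
    · -- own window
      have hxt : t i < ⟪x, n i⟫_ℝ := hGt i j hi x hx
      have hpi : s i < ⟪p, n i⟫_ℝ := (hmemO _ p).1 hp.2.2 i hi
      show t i + r * s i < ⟪x + r • p, n i⟫_ℝ
      rw [h1]
      have h2 : r * s i < r * ⟪p, n i⟫_ℝ := mul_lt_mul_of_pos_left hpi hr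
      linarith
    · rw [Metric.mem_thickening_iff]
      refine ⟨x, hxNd, ?_⟩
      rw [dist_eq_norm, add_sub_cancel_left, norm_smul, Real.norm_of_nonneg hr.le, hρ]
      calc r * ‖p‖ ≤ r * Real.sqrt 5 := by gcongr
        _ < r * (Real.sqrt 5 + 1) := by nlinarith
  -- per-node bounds from `hnode`, summed by the root-form docking lemma
  rw [hV, hUnion]
  refine chimera_lower_of_piece_root_bounds Nd hNdm hdisjNd (hUnion ▸ h0) (hUnion ▸ htop)
    (by norm_num : (0:ℝ) < 32) hr (fun f => U ∩ R f) (fun f => hU.inter (hRm f)) hdisjR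
    (fun f => inter_subset_left) fun f hf0 => ?_
  have hσpos : 0 < σ f := div_pos (ENNReal.toReal_pos hf0 (hNdfin f)) hVr0
  have hT0 : volume (T f) ≠ 0 := fun h0' => by
    have h := hTvol f
    rw [h0'] at h
    exact absurd (le_antisymm h bot_le) (ENNReal.ofReal_pos.2 (by positivity)).ne'
  have hkey := hnode f s (U ∩ R f) (hU.inter (hRm f)) hf0 hT0
    (fun j hj x hx y hy => by have h := hinc j x hx y (hj ▸ hy); rwa [hj] at h)
  have hVeq : (volume (⋃ f, Nd f)).toReal = Vr := by rw [hVr, hV, hUnion]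
  rw [hVeq]
  calc volume (Nd f) ^ ((3 : ℕ)⁻¹ : ℝ) + ENNReal.ofReal r *
        (ENNReal.ofReal (32 * ((volume (Nd f)).toReal / Vr))) ^ ((3 : ℕ)⁻¹ : ℝ)
      ≤ volume (Nd f) ^ ((3 : ℕ)⁻¹ : ℝ) + ENNReal.ofReal r * (volume (T f)) ^ ((3 : ℕ)⁻¹ : ℝ) := by
        gcongr
        exact hTvol f
    _ ≤ volume (U ∩ R f) ^ ((3 : ℕ)⁻¹ : ℝ) := hkey

end Summit.Ventures.Crystal3D.Theorems

end
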